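import Summits.PneNP.PneNP.Theorems.ExpanderLinearGeneratorsResolutionRung

/-!
# PneNP / ExpanderLinearGenerators — hardness pulls back along sparse `𝔽₂`-linear recodings

Route `PneNP/ExpanderLinearGenerators`, crux stmt-PneNP-11443
(`Summit.PneNP.PneNP.Theses.ExpanderLinearGenerators.LinearGeneratorDepthFregeHard`). The slice
`LinGen.linearGeneratorDepthFregeHard_of_light_expansion` (the light variables carry the expansion)
is the case "restriction" of a general closure property of bounded-depth Frege hardness of
XOR-systems: if `E'` is a system in variables `y₀, …, y_{n'-1}` and `R t ⊆ {0, …, n-1}` are sets of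
at most `s` new variables, the RECODED system `E = E' ∘ (y_t := ⊕_{j ∈ R t} z_j)` (row `i` of `E` has
coefficient `Σ_t E'ᵢ(t) [j ∈ R t]` at `z_j` and the right-hand side of `E'`) satisfies: every
depth-`d` `textbookFrege` refutation of `sumEncoding 1 E'` yields, by GIRS's transfer lemma with the
parity-gadget substitution (`parityForm`, size `≤ 9 · 2^s`, depth `≤ 3s`), a
depth-`(d + 3s + 16)` refutation of `sumEncoding 1 E` of polynomially related size. Hence, if `E'`
is unsolvable (then so is `E`) and the recoded system `E` is `ℓ`-sparse with light parts carrying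
the `(n^{1-δ}, 3ℓ/4)`-expansion, then `E'` is exponentially hard. Restriction to
zero outside `L` is the recoding `R t = {t}` (`t ∈ L`), `R t = ∅` (`t ∉ L`); invertible sparse
recodings (`x_e := y_e ⊕ y_{σ e}` along an injection `σ` with disjoint range) produce hard systems
with heavy variables whose own light parts need not expand — so the open core of the crux is the
class of systems NO sparse recoding of which is light-expanding.

* `exists_xorProof_of_rowLocalV` — the packaged transfer with explicit variable lists;
* `holds_recode_iff` — `E' i` holds at `y := R·z` iff `E i` holds at `z`;
* `linearGeneratorDepthFregeHard_of_sparse_recoding` — the closure property as a slice of the crux.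

References: N. Galesi, D. Itsykson, A. Riazanov, A. Sofronova, APAL 174 (2023), Lemma 10, §3.1;
J. Krajíček, *Proof complexity* (CUP 2019), Problem 19.4.5.
-/

namespace Summit.PneNP.PneNP.Theorems.LinGen

open Filter Finset Literature.Computability.MetaComplexity
open Literature.Computability.MetaComplexity.TextbookFrege
open Literature.Computability.Complexity (PropForm Clause CNF Literal)
open Literature.Computability.Complexity.PropForm
open Literature.Computability.MetaComplexity.KrajicekRamsey (clauseOf)
open Summit.PneNP.PneNP.Theorems.GridRouting Summit.PneNP.PneNP.Theorems.ColumnTwo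

variable {m n n' : ℕ}

/-! ### The packaged transfer with explicit variable lists -/

/-- **Transfer onto an `ℓ`-sparse XOR-system, with explicit truth-table variables.** As
`exists_xorProof_of_rowLocal`, but the substitution may have size `≤ Zσ` and depth `≤ Tσ`, and the
variables of a substituted clause need only lie in a duplicate-free list `V ⊇ eqVars 1 (E' i)` of
length `≤ k` (any `k`). [Galesi–Itsykson–Riazanov–Sofronova 2023, Lemma 10] [folklore] -/
theorem exists_xorProof_of_rowLocalV {d ℓ Zσ Tσ k : ℕ} {π : List (PropForm ℕ)} (T : CNF ℕ)
    (E' : Fin m → LinEqMod 2 n) (σ : ℕ → PropForm ℕ)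
    (hZ : ∀ x, (σ x).size ≤ Zσ) (hZ1 : 1 ≤ Zσ) (hT : ∀ x c, altDepthAux c (σ x) ≤ Tσ)
    (hℓ : ∀ i, (E' i).supp.card ≤ ℓ)
    (hπ : textbookFrege.IsDepthProofOf d π (neg (PropForm.ofCNF T)))
    (hloc : ∀ c ∈ T, ∃ i, ∃ V : List ℕ, V.Nodup ∧ V.length ≤ k ∧
      (∀ x ∈ ((clauseOf c).subst σ).vars, x ∈ V) ∧ (∀ x ∈ eqVars 1 (E' i), x ∈ V) ∧
      ∀ τ : ℕ → Bool, (E' i).Holds (blockVals 2 1 n τ) → ((clauseOf c).subst σ).eval τ = true) :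
    ∃ π', textbookFrege.IsDepthProofOf (d + Tσ + 16) π' (neg (PropForm.ofCNF (sumEncoding 1 E'))) ∧
      proofSize π' ≤ transferLines (proofSize π) (proofSize π * Zσ + m * (2 ^ ℓ * (3 * ℓ + 2))) (2 ^ ℓ) k *
        (40 * ((2 ^ ℓ + 3) * (proofSize π * Zσ + m * (2 ^ ℓ * (3 * ℓ + 2)) + 3) + k) + 300) := by
  set T' := sumEncoding 1 E' with hT'
  have htr := transfer_isDepthProofOf T T' σ (Zσ := Zσ) (Tσ := Tσ) (qq := 2 ^ ℓ) (k := k) hZ hZ1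
    hT hπ ?_
  · obtain ⟨π', hπ', hsize⟩ := htr
    refine ⟨π', hπ', hsize.trans ?_⟩
    have hm : proofSize π * Zσ + msum (T'.map clauseOf) ≤ proofSize π * Zσ + m * (2 ^ ℓ * (3 * ℓ + 2)) :=
      Nat.add_le_add_left (msum_sumEncoding_le E' hℓ) _
    have h2 := Nat.mul_le_mul_left (2 ^ ℓ + 3) (Nat.add_le_add_right hm 3)
    exact Nat.mul_le_mul (transferLines_mono le_rfl hm) (by omega)
  intro c hc
  obtain ⟨i, V, hV, hVk, hvars, hVeq, himp⟩ := hloc c hc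
  refine ⟨equationCNF 1 (E' i), V, ?_, ?_, hV, hVk, hvars, ?_, ?_⟩
  · intro K hK
    simp only [hT', sumEncoding, List.mem_flatMap, List.mem_finRange, true_and]
    exact ⟨i, hK⟩
  · exact (length_equationCNF_le (E' i)).trans (Nat.pow_le_pow_right (by norm_num) (hℓ i))
  · intro K hK x hx
    obtain ⟨l, hl, rfl⟩ := exists_literal_of_mem_vars_clauseOf hx
    exact hVeq _ (fst_mem_of_mem_canonicalCNF hK hl)
  · intro τ hτ
    refine himp τ ?_
    have hall := eval_equationCNF 1 (E' i) τ
    have hev : (equationCNF 1 (E' i)).eval τ = true := by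
      rw [CNF.eval_eq_true_iff]
      intro K hK
      have := hτ K hK
      rwa [OntoPHPReduction.eval_clauseOf] at this
    rw [hev] at hall
    exact of_decide_eq_true hall.symm

/-! ### Recoding along `y_t := ⊕_{j ∈ R t} z_j` -/

section Recode

variable {R : Fin n' → Finset (Fin n)} {E' : Fin m → LinEqMod 2 n'} {E : Fin m → LinEqMod 2 n}
  (hE : ∀ i j, (E i).1 j = ∑ t ∈ (E' i).supp, if j ∈ R t then (1 : ZMod 2) else 0)

include hE

/-- The support of a recoded row lies in the union of the recoding sets of its source support.
[folklore] -/
theorem supp_recode_subset (i : Fin m) : (E i).supp ⊆ (E' i).supp.biUnion R := by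
  intro j hj
  rw [LinEqMod.supp, Finset.mem_filter] at hj
  rw [Finset.mem_biUnion]
  by_contra h
  push Not at h
  apply hj.2
  rw [hE i j]
  exact Finset.sum_eq_zero fun t ht => if_neg (h t ht)

/-- **The recoded equation.** `E' i` holds at the assignment `y_t := ⊕_{j ∈ R t} τ j` iff `E i`
holds at `τ` (swap the two sums). [folklore] -/
theorem holds_recode_iff (hb : ∀ i, (E i).2 = (E' i).2) (τ : ℕ → Bool) (i : Fin m)
    (y : ℕ → Bool) (hy : ∀ t : Fin n', (if y t then (1 : ZMod 2) else 0) =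
      ∑ j ∈ R t, if τ j then (1 : ZMod 2) else 0) :
    (E' i).Holds (blockVals 2 1 n' y) ↔ (E i).Holds (blockVals 2 1 n τ) := by
  classical
  rw [holds_blockVals_iff, holds_blockVals_iff, hb i, sum_coeff_mul]
  have h1 : ∑ t ∈ (E' i).supp, (if y t then (1 : ZMod 2) else 0) =
      ∑ t ∈ (E' i).supp, ∑ j ∈ R t, (if τ j then (1 : ZMod 2) else 0) :=
    Finset.sum_congr rfl fun t _ => hy t
  have h2 : ∑ j, (E i).1 j * (if τ j then (1 : ZMod 2) else 0) =
      ∑ j, ∑ t ∈ (E' i).supp, (if j ∈ R t then (1 : ZMod 2) else 0) * (if τ j then 1 else 0) :=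
    Finset.sum_congr rfl fun j _ => by rw [hE i j, Finset.sum_mul]
  rw [h1, h2, Finset.sum_comm]
  have h3 : ∀ t ∈ (E' i).supp, ∑ j ∈ R t, (if τ (j : ℕ) then (1 : ZMod 2) else 0) =
      ∑ j, (if j ∈ R t then (1 : ZMod 2) else 0) * (if τ j then 1 else 0) := by
    intro t _
    rw [← Finset.sum_filter_add_sum_filter_not Finset.univ (fun j => j ∈ R t)]
    have e1 : (Finset.univ.filter fun j => j ∈ R t) = R t := by ext j; simp
    rw [e1, Finset.sum_eq_zero (s := Finset.univ.filter fun j => ¬ j ∈ R t) (fun j hj => by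
      rw [Finset.mem_filter] at hj; rw [if_neg hj.2, zero_mul]), add_zero]
    exact Finset.sum_congr rfl fun j hj => by rw [if_pos hj, one_mul]
  rw [Finset.sum_congr rfl h3]

end Recode

/-! ### The closure property -/

/-- **Hardness pulls back along sparse linear recodings** (a slice of the crux containing
`linearGeneratorDepthFregeHard_of_light_expansion`). For `ℓ ≥ 1`, `ℓ'`, `s`, `0 < δ < 1` and depth
`d` there are `ε > 0` and `N` such that for `n ≥ N`: whenever `E'` is an `ℓ'`-sparse unsolvable
system over `𝔽₂` in `n'` variables, `R t` (`t < n'`) are sets of at most `s` of the variables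
`z₀, …, z_{n-1}`, and the recoded system `E = E' ∘ (y_t := ⊕_{j ∈ R t} z_j)` is `ℓ`-sparse with
light parts forming an `(n^{1-δ}, 3ℓ/4)`-boundary expander, every depth-`d` `textbookFrege` proof of
`¬(sumEncoding 1 E')` has size `≥ 2^{n^ε}`. Proof: the parity-gadget substitution moves the
refutation onto `sumEncoding 1 E` (`exists_xorProof_of_rowLocalV`, `holds_recode_iff`) at depth
`d + 3s + 16` and polynomial cost; `E` is unsolvable as `E'` is; then
`linearGeneratorDepthFregeHard_of_light_expansion`. [Galesi et al. 2023, Lemma 10; Krajíček 2019,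
Problem 19.4.5] -/
theorem linearGeneratorDepthFregeHard_of_sparse_recoding :
    ∀ (ℓ ℓ' s d : ℕ) (δ : ℝ), 1 ≤ ℓ → 0 < δ → δ < 1 → ∃ ε : ℝ, 0 < ε ∧ ∃ N : ℕ, ∀ n : ℕ, N ≤ n →
      ∀ (m n' : ℕ) (E' : Fin m → LinEqMod 2 n') (R : Fin n' → Finset (Fin n))
        (E : Fin m → LinEqMod 2 n),
      (∀ t, (R t).card ≤ s) → (∀ i, (E' i).supp.card ≤ ℓ') →
      (∀ i j, (E i).1 j = ∑ t ∈ (E' i).supp, if j ∈ R t then (1 : ZMod 2) else 0) →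
      (∀ i, (E i).2 = (E' i).2) →
      (∀ i, (E i).supp.card ≤ ℓ) →
      IsBoundaryExpander
        (fun i => ((E i).supp.filter fun j =>
          (Finset.univ.filter fun i' => j ∈ (E i').supp).card ≤ 2).map Fin.valEmbedding)
        ((n : ℝ) ^ (1 - δ)) (3 / 4 * ℓ) →
      ¬ SystemSat E' Finset.univ →
      ∀ π : List (PropForm ℕ),
        textbookFrege.IsDepthProofOf d π (PropForm.neg (PropForm.ofCNF (sumEncoding 1 E'))) →
          (2 : ℝ) ^ ((n : ℝ) ^ ε) ≤ (proofSize π : ℝ) := by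
  intro ℓ ℓ' s d δ hℓ hδ hδ1
  obtain ⟨ε, hε, N₁, hN₁⟩ :=
    linearGeneratorDepthFregeHard_of_light_expansion ℓ (d + 3 * s + 16) δ hℓ hδ hδ1
  set k : ℕ := ℓ' * s with hk
  obtain ⟨Cst, hCst, hbound⟩ := transferBound_poly (2 ^ ℓ) k
  set W : ℕ := 2 ^ ℓ * (3 * ℓ + 2) with hW
  set Zs : ℕ := 9 * 2 ^ s with hZs
  have hZs1 : 1 ≤ Zs := by rw [hZs]; have := Nat.one_le_two_pow (n := s); omega
  have hε2 : 0 < ε / 2 := by positivity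
  obtain ⟨N₂, hN₂⟩ := eventually_atTop.1 ((eventually_lb_params (Cst * (Zs + 1) ^ 3) hε).and
    ((Literature.Computability.Complexity.eventually_pow_lt_two_rpow_rpow (ℓ + 1) hε2).and
    ((((tendsto_rpow_atTop (by linarith : (0 : ℝ) < 1 - δ)).comp
      tendsto_natCast_atTop_atTop).eventually_ge_atTop 2).and
    (eventually_ge_atTop ((ℓ + 1) * W + 3)))))
  refine ⟨ε / 2, hε2, max N₁ N₂, ?_⟩
  intro n hn m n' E' R E hs hℓ' hE hb hℓE hexp hunsat π hπ
  obtain ⟨⟨-, hc2, h4, hn1⟩, hpow, hr2, hnW⟩ := hN₂ n (le_trans (le_max_right _ _) hn)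
  classical
  -- the recoded system is unsolvable
  have hunsatE : ¬ SystemSat E Finset.univ := by
    rintro ⟨z, hz⟩
    apply hunsat
    let τ : ℕ → Bool := fun x => if h : x < n then decide (z ⟨x, h⟩ = 1) else false
    have hτ : blockVals 2 1 n τ = z := by
      rw [OntoPHPReduction.blockVals_one]
      funext j
      have h01 : ∀ a : ZMod 2, a = 0 ∨ a = 1 := by decide
      simp only [τ, j.2, dif_pos, Fin.eta]
      rcases h01 (z j) with h | h <;> simp [h]
    let y : ℕ → Bool := fun t => if h : t < n' then
      decide ((∑ j ∈ R ⟨t, h⟩, if τ j then (1 : ZMod 2) else 0) = 1) else false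
    refine ⟨blockVals 2 1 n' y, fun i _ => ?_⟩
    refine (holds_recode_iff hE hb τ i y fun t => ?_).2 (by rw [hτ]; exact hz i (Finset.mem_univ _))
    have h01 : ∀ a : ZMod 2, a = 0 ∨ a = 1 := by decide
    simp only [y, t.2, dif_pos, Fin.eta]
    rcases h01 (∑ j ∈ R t, if τ j then (1 : ZMod 2) else 0) with h | h <;> simp [h]
  -- the substitution
  set σ : ℕ → PropForm ℕ := fun t => if h : t < n' then
    parityForm false (((R ⟨t, h⟩).sort (· ≤ ·)).map Fin.val) else var t with hσdef
  have hlenR : ∀ t : Fin n', (((R t).sort (· ≤ ·)).map Fin.val).length ≤ s := fun t => by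
    rw [List.length_map, Finset.length_sort]; exact hs t
  have hZ : ∀ x, (σ x).size ≤ Zs := by
    intro x
    simp only [hσdef]
    split_ifs with h
    · have h1 := size_parityForm_le false (((R ⟨x, h⟩).sort (· ≤ ·)).map Fin.val)
      have h2 : 2 ^ (((R ⟨x, h⟩).sort (· ≤ ·)).map Fin.val).length ≤ 2 ^ s :=
        Nat.pow_le_pow_right (by norm_num) (hlenR _)
      rw [hZs]; omega
    · simp only [size]; omega
  have hT : ∀ x c, altDepthAux c (σ x) ≤ 3 * s := by
    intro x c
    simp only [hσdef]
    split_ifs with h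
    · exact (altDepthAux_parityForm_le false _ c).trans (Nat.mul_le_mul_left 3 (hlenR _))
    · simp [altDepthAux]
  -- the local implications
  have hloc : ∀ c ∈ sumEncoding 1 E', ∃ i, ∃ V : List ℕ, V.Nodup ∧ V.length ≤ k ∧
      (∀ x ∈ ((clauseOf c).subst σ).vars, x ∈ V) ∧ (∀ x ∈ eqVars 1 (E i), x ∈ V) ∧
      ∀ τ : ℕ → Bool, (E i).Holds (blockVals 2 1 n τ) → ((clauseOf c).subst σ).eval τ = true := by
    intro c hc
    simp only [sumEncoding, List.mem_flatMap, List.mem_finRange, true_and] at hc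
    obtain ⟨i, hi⟩ := hc
    set U : Finset (Fin n) := (E' i).supp.biUnion R with hU
    refine ⟨i, (U.sort (· ≤ ·)).map Fin.val, (Finset.sort_nodup _ _).map Fin.val_injective, ?_, ?_,
      ?_, ?_⟩
    · rw [List.length_map, Finset.length_sort, hk]
      refine Finset.card_biUnion_le.trans ?_
      calc ∑ t ∈ (E' i).supp, (R t).card ≤ ∑ _t ∈ (E' i).supp, s := Finset.sum_le_sum fun t _ => hs t
        _ = (E' i).supp.card * s := by rw [Finset.sum_const, smul_eq_mul]
        _ ≤ ℓ' * s := Nat.mul_le_mul_right _ (hℓ' i)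
    · intro x hx
      obtain ⟨y, hy, hxy⟩ := mem_vars_subst hx
      obtain ⟨l, hl, rfl⟩ := exists_literal_of_mem_vars_clauseOf hy
      have hv : l.1 ∈ eqVars 1 (E' i) := by
        rw [equationCNF] at hi
        exact fst_mem_of_mem_canonicalCNF hi hl
      obtain ⟨t, ht, hlt⟩ := mem_eqVars.1 hv
      obtain ⟨j0, hj0, hl1⟩ := mem_encBlock.1 hlt
      have hl1' : l.1 = (t : ℕ) := by omega
      rw [hl1'] at hxy
      simp only [hσdef, dif_pos t.2, Fin.eta] at hxy
      have hxR := mem_vars_parityForm hxy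
      rw [List.mem_map] at hxR
      obtain ⟨j, hj, rfl⟩ := hxR
      rw [Finset.mem_sort] at hj
      refine List.mem_map.2 ⟨j, ?_, rfl⟩
      rw [Finset.mem_sort, hU, Finset.mem_biUnion]
      exact ⟨t, ht, hj⟩
    · intro x hx
      obtain ⟨j, hj, hxj⟩ := mem_eqVars.1 hx
      obtain ⟨j0, hj0, hx1⟩ := mem_encBlock.1 hxj
      have hx1' : x = (j : ℕ) := by omega
      subst hx1'
      refine List.mem_map.2 ⟨j, ?_, rfl⟩
      rw [Finset.mem_sort, hU]
      exact supp_recode_subset hE i hj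
    · intro τ hτ
      rw [eval_subst, OntoPHPReduction.eval_clauseOf]
      set y : ℕ → Bool := fun v => (σ v).eval τ with hy
      have hyt : ∀ t : Fin n', (if y t then (1 : ZMod 2) else 0) =
          ∑ j ∈ R t, if τ j then (1 : ZMod 2) else 0 := by
        intro t
        simp only [hy, hσdef, dif_pos t.2, Fin.eta]
        rw [ite_eval_parityForm]
        simp only [Bool.false_eq_true, if_false, zero_add]
        rw [List.map_map]
        have hnd : (((R t).sort (· ≤ ·)).map Fin.val).Nodup := (Finset.sort_nodup _ _).map Fin.val_injective
        have := List.sum_toFinset (fun x : ℕ => if τ x then (1 : ZMod 2) else 0) hnd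
        rw [List.map_map] at this
        rw [← this]
        have e : (((R t).sort (· ≤ ·)).map Fin.val).toFinset = (R t).map Fin.valEmbedding := by
          ext v; simp [Finset.mem_sort]
        rw [e, Finset.sum_map]
        rfl
      have hholds := (holds_recode_iff hE hb τ i y hyt).2 hτ
      have hall := eval_equationCNF 1 (E' i) y
      rw [decide_eq_true hholds, CNF.eval_eq_true_iff] at hall
      exact hall c hi
  -- transfer, and the slice for the recoded system
  obtain ⟨π', hπ', hsize⟩ := exists_xorProof_of_rowLocalV (sumEncoding 1 E') E σ hZ hZs1 hT hℓE
    hπ hloc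
  have hlb := hN₁ n (le_trans (le_max_left _ _) hn) m E hℓE hexp hunsatE π' hπ'
  -- sizes
  have hn1' : 1 ≤ n := hn1
  have hm : m ≤ (ℓ + 1) * n ^ ℓ :=
    ResSim.card_rows_le_of_light_expansion E hr2 (mul_pos (by norm_num) (by exact_mod_cast hℓ)) hℓE hn1' hexp
  set S := proofSize π with hS
  have hsz : proofSize π' ≤ Cst * (Zs * S + m * W + 3) ^ 3 := by
    refine hsize.trans ((hbound S (S * Zs + m * W) ?_).trans ?_)
    · exact le_trans (Nat.le_mul_of_pos_right _ hZs1) (Nat.le_add_right _ _)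
    · rw [mul_comm S Zs]
  refine lb_of_poly (ε := ε) (ε' := ε / 2) (T := Cst) (a := Zs) (b := m * W) hlb hsz ?_ ?_ h4
  · -- `m W + 3 ≤ (ℓ+1) W n^ℓ + 3 ≤ n^{ℓ+1} < 2^{n^{ε/2}}`
    have h1 : m * W + 3 ≤ n ^ (ℓ + 1) := by
      have h2 : m * W ≤ (ℓ + 1) * W * n ^ ℓ := by
        calc m * W ≤ (ℓ + 1) * n ^ ℓ * W := Nat.mul_le_mul_right _ hm
          _ = (ℓ + 1) * W * n ^ ℓ := by ring
      have h3 : ((ℓ + 1) * W + 3) * n ^ ℓ ≤ n * n ^ ℓ := Nat.mul_le_mul_right _ hnW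
      have h4' : 3 ≤ 3 * n ^ ℓ := Nat.le_mul_of_pos_right _ (Nat.one_le_pow _ _ hn1')
      rw [pow_succ, mul_comm (n ^ ℓ) n]
      nlinarith
    have h1' : ((m * W : ℕ) : ℝ) + 3 ≤ (n : ℝ) ^ (ℓ + 1) := by exact_mod_cast h1
    have h2 : ((n : ℝ) ^ (ℓ + 1) : ℝ) < (2 : ℝ) ^ ((n : ℝ) ^ (ε / 2)) := by simpa using hpow
    linarith
  · have : ((Cst : ℝ) * (((Zs : ℕ) : ℝ) + 1) ^ 3) = ((Cst * (Zs + 1) ^ 3 : ℕ) : ℝ) := by push_cast; ring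
    rw [this]
    exact hc2

end Summit.PneNP.PneNP.Theorems.LinGen
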